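import Literature.Probability.RandomPlanarGeometry.HexSAWSurfaceWallRenewal
import HarnessLib

/-!
# Explicit geometric rate for the adsorbed wall-bridge renewal amplitudes (elementary majorant series)

[cite: MadrasSlade1993, §4.2 Theorem 4.2.2(b) (pp. 91–92) and Appendix B] — the renewal structure of bridges and
the renewal theorem used there; [cite: Feller1968, XIII.3 and XIII.10] — renewal sequences with geometric tails
converge geometrically; [cite: Bednorz2013, §2 p. 5] — the quantitative (complex-analytic) form, NOT used here;
[cite: BeatonBousquetMelouDeGierDuminilCopinGuttmann2014, §3.1 Proposition 5] — the wall-bridge setting.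

## What this module does

The parent module `HexSAWSurfaceWallRenewal` proves, for surface fugacity `y > μ⁴` (`μ = hexConnectiveConstant`),
that the normalised positive-wall-bridge amplitudes `pwbAmp y s = PWB (2s) y / wallRate y ^ (2s)` form a renewal
sequence with inter-arrival law `pwbLaw y`, mean `pwbMean y = m(y)`, geometric envelope
`pwbLaw y s ≤ μ²√y · θ^s` (`θ = μ²/√y < 1`), and it imports the tree's ELEMENTARY explicit renewal rate
(`Literature.Probability.Process.Renewal.abs_sub_inv_tsum_le`) as
`abs_pwbAmp_sub_inv_pwbMean_le : … HasSum (r_{j+1} ρ^{j+1}) G → G < 1 → HasSum (r_{j+1} Σ_{l≤j} ρ^l) H →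
|pwbAmp y s − m(y)⁻¹| ≤ H/(m(y)(1 − G)) · ρ^{-s}` with the tail sums `r_k = 1 − Σ_{i≤k} pwbLaw y i`.
Its data `G`, `H` were left abstract.  Here they are made EXPLICIT (§1 model-free, §2 for the wall-bridge law):

* `G(ρ) = Σ_{k≥1} r_k ρ^k ≤ ρ^J (m − 1) + T_J(ρ)` for every cut `J : ℕ`, where the first `J` terms are bounded
  through `Σ_{k≥1} r_k = m − 1` and the others through the envelope, `T_J(ρ) = C θ^{J+2} ρ^{J+1}/((1−θ)(1−θρ))`
  (`RenewalRate.exists_hasSum_weighted_tail_le`, `rateTail`);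
* `H(ρ) = (G(ρ) − (m − 1))/(ρ − 1)` exactly, for `ρ > 1` (`RenewalRate.hasSum_H_of_hasSum_G`);
* ★★ `abs_pwbAmp_sub_inv_pwbMean_le_explicit`: for `y > μ⁴`, `1 < ρ`, `θρ < 1`, a cut `J`, ANY certified mean
  bound `pwbMean y ≤ mup` and any `G₀` with `ρ^J (mup − 1) + rateTail y ρ J ≤ G₀ < 1`:
  `|pwbAmp y s − (pwbMean y)⁻¹| ≤ G₀/((ρ − 1)(1 − G₀)) · ρ⁻¹ ^ s` for every `s`.

So an explicit mean bound (the sibling module `HexSAWSurfaceWallRenewalMean`: `m(y) ≤ 1 + (1 − y/B)(…)` from a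
certified window `β(y)² ≤ B`) is converted into an explicit GEOMETRIC RATE of the renewal limit
`P_{2s}(y) β(y)^{-2s} → 1/m(y)`, with no complex analysis, whenever `mup < 2` leaves room for a cut `J`.
ILLUSTRATIVE NUMBERS (floating point, NOT certified here; `mup` from the sibling module with the tree window
`B = y + 6/y`): `y = 30`: `mup = 1.164`, `ρ = 1.05`, `J = 17` ⇒ `G₀ = 0.42`, constant `14.4`;
`y = 50`: `mup = 1.041`, `ρ = 1.2`, `J = 11` ⇒ `G₀ = 0.38`, `|P_{2s}β^{-2s} − 1/m| ≤ 3.1 · 1.2^{-s}`;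
`y = 100`: `mup = 1.0075`, `ρ = 1.4`, `J = 8` ⇒ `≤ 0.46 · 1.4^{-s}`; `y = 25`: `ρ = 1.02`, `J = 23`, constant `45`.
Below `y ≈ 25` no window certifies `mup < 2` and this elementary route closes nothing; there the
quantitative Kendall theorem [cite: Bednorz2013, Theorem 1.1 / Corollary 2.5] is the tool (not formalised).
LABEL: the rate mechanism is the tree's (CONSOLIDATION); the explicit data (`J`-cut of `G`, closed form of `H`) and
the resulting explicit constants for the adsorbed wall-bridge law are NEW-IN-WRITING (modest).
-/

namespace Literature.Probability.RandomPlanarGeometry.SAW.HexBW.Wall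

open Finset Filter
open _root_.Topology

namespace RenewalRate

variable {f : ℕ → ℝ}

/-- Tail bound from a geometric envelope: if `f_n ≤ C θ^n` for all `n`, `0 ≤ θ < 1` and `Σ f = 1`, then the tail
`r_k = 1 − Σ_{i≤k} f_i = Σ_{i>k} f_i ≤ C θ^{k+1}/(1 − θ)`.
[cite: Feller1968, XIII.3] -/
theorem tailSum_le_geom (hf1 : HasSum f 1) {C θ : ℝ} (henv : ∀ n, f n ≤ C * θ ^ n) (hθ0 : 0 ≤ θ) (hθ1 : θ < 1)
    (k : ℕ) : 1 - ∑ i ∈ range (k + 1), f i ≤ C * θ ^ (k + 1) / (1 - θ) := by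
  have htail : HasSum (fun n => f (n + (k + 1))) (1 - ∑ i ∈ range (k + 1), f i) :=
    (hasSum_nat_add_iff' (k + 1)).mpr hf1
  have hmaj : HasSum (fun n : ℕ => C * θ ^ (k + 1) * θ ^ n) (C * θ ^ (k + 1) * (1 - θ)⁻¹) :=
    (hasSum_geometric_of_lt_one hθ0 hθ1).mul_left _
  have hle := hasSum_le (fun n => by
    calc f (n + (k + 1)) ≤ C * θ ^ (n + (k + 1)) := henv _
      _ = C * θ ^ (k + 1) * θ ^ n := by rw [pow_add]; ring) htail hmaj
  simpa [div_eq_mul_inv] using hle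

/-- The tail sums of a probability sequence with finite mean are summable, with sum the mean:
`HasSum (k ↦ r_k) (Σ j f_j)` where `r_k = 1 − Σ_{i≤k} f_i` (so `r_0 = 1` when `f_0 = 0`).
[cite: MadrasSlade1993, Appendix B] -/
theorem hasSum_tailSum (hf : ∀ k, 0 ≤ f k) (hf1 : HasSum f 1)
    (hmean : Summable fun k : ℕ => (k : ℝ) * f k) :
    HasSum (fun k => 1 - ∑ i ∈ range (k + 1), f i) (∑' j : ℕ, (j : ℝ) * f j) := by
  set r : ℕ → ℝ := fun k => 1 - ∑ i ∈ range (k + 1), f i with hrdef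
  have hr : ∀ n, r n = 1 - ∑ i ∈ range (n + 1), f i := fun n => rfl
  have hrnn : ∀ k, 0 ≤ r k := fun k => Literature.Probability.Process.Renewal.tailSum_nonneg hr hf hf1 k
  have ht := Literature.Probability.Process.Renewal.tendsto_sum_range_tailSum hr hf hf1 hmean
  have ht' : Tendsto (fun K => ∑ k ∈ range K, r k) atTop (𝓝 (∑' j : ℕ, (j : ℝ) * f j)) :=
    (tendsto_add_atTop_iff_nat 1).1 ht
  exact (hasSum_iff_tendsto_nat_of_nonneg hrnn _).2 ht'

/-- Shifted form: `HasSum (j ↦ r_{j+1}) (m − 1)` when `f_0 = 0` (`m = Σ j f_j`).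
[cite: MadrasSlade1993, Appendix B] -/
theorem hasSum_tailSum_succ (hf : ∀ k, 0 ≤ f k) (hf0 : f 0 = 0) (hf1 : HasSum f 1)
    (hmean : Summable fun k : ℕ => (k : ℝ) * f k) :
    HasSum (fun j => 1 - ∑ i ∈ range (j + 2), f i) ((∑' j : ℕ, (j : ℝ) * f j) - 1) := by
  have h := (hasSum_nat_add_iff' 1).mpr (hasSum_tailSum hf hf1 hmean)
  simpa [sum_range_one, hf0] using h

/-- ★ The `J`-cut bound on the weighted tail series.  For a probability sequence `f` (`f_0 = 0`, `Σ f = 1`, finite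
mean `m = Σ j f_j`) with envelope `f_n ≤ C θ^n` (`0 ≤ C`, `0 ≤ θ < 1`), every `ρ ≥ 1` with `θρ < 1` and every
cut `J : ℕ`: the series `G(ρ) = Σ_{j≥0} r_{j+1} ρ^{j+1}` converges and
`G(ρ) ≤ ρ^J (m − 1) + C θ^{J+2} ρ^{J+1}/((1 − θ)(1 − θρ))`
(terms `k = j+1 ≤ J` through `ρ^k ≤ ρ^J` and `Σ_{k≥1} r_k = m − 1`; terms `k > J` through the envelope tail).
[cite: Feller1968, XIII.10] -/
theorem exists_hasSum_weighted_tail_le (hf : ∀ k, 0 ≤ f k) (hf0 : f 0 = 0) (hf1 : HasSum f 1)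
    (hmean : Summable fun k : ℕ => (k : ℝ) * f k) {C θ : ℝ} (hC : 0 ≤ C) (henv : ∀ n, f n ≤ C * θ ^ n)
    (hθ0 : 0 ≤ θ) (hθ1 : θ < 1) {ρ : ℝ} (hρ : 1 ≤ ρ) (hθρ : θ * ρ < 1) (J : ℕ) :
    ∃ G, HasSum (fun j : ℕ => (1 - ∑ k ∈ range (j + 2), f k) * ρ ^ (j + 1)) G ∧
      G ≤ ρ ^ J * ((∑' j : ℕ, (j : ℝ) * f j) - 1) + C * θ ^ (J + 2) * ρ ^ (J + 1) / ((1 - θ) * (1 - θ * ρ)) := by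
  set m : ℝ := ∑' j : ℕ, (j : ℝ) * f j with hmdef
  set a : ℕ → ℝ := fun j => (1 - ∑ k ∈ range (j + 2), f k) * ρ ^ (j + 1) with hadef
  have hρ0 : 0 < ρ := by linarith
  have hθρ0 : 0 ≤ θ * ρ := mul_nonneg hθ0 hρ0.le
  have h1θ : 0 < 1 - θ := by linarith
  have h1θρ : 0 < 1 - θ * ρ := by linarith
  have hr' := hasSum_tailSum_succ hf hf0 hf1 hmean
  -- nonnegativity of the tails
  have hrnn' : ∀ j, 0 ≤ 1 - ∑ k ∈ range (j + 2), f k := fun j => by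
    have := sum_le_hasSum (range (j + 2)) (fun k _ => hf k) hf1
    linarith
  have hann : ∀ j, 0 ≤ a j := fun j => mul_nonneg (hrnn' j) (pow_nonneg hρ0.le _)
  -- envelope bound on each term: a_j ≤ (C θ/(1-θ)) (θρ)^{j+1}
  have htail : ∀ j, 1 - ∑ k ∈ range (j + 2), f k ≤ C * θ ^ (j + 2) / (1 - θ) := fun j =>
    tailSum_le_geom hf1 henv hθ0 hθ1 (j + 1)
  have hamaj : ∀ j, a j ≤ C * θ / (1 - θ) * (θ * ρ) ^ (j + 1) := fun j => by
    have h := mul_le_mul_of_nonneg_right (htail j) (pow_nonneg hρ0.le (j + 1))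
    calc a j = (1 - ∑ k ∈ range (j + 2), f k) * ρ ^ (j + 1) := rfl
      _ ≤ C * θ ^ (j + 2) / (1 - θ) * ρ ^ (j + 1) := h
      _ = C * θ / (1 - θ) * (θ * ρ) ^ (j + 1) := by rw [mul_pow]; field_simp; ring
  -- summability by comparison with the geometric majorant
  have hmajsum : Summable fun j : ℕ => C * θ / (1 - θ) * (θ * ρ) ^ (j + 1) := by
    have hg : Summable fun j : ℕ => (θ * ρ) ^ j := summable_geometric_of_lt_one hθρ0 hθρ
    exact ((hg.mul_left (θ * ρ)).mul_left (C * θ / (1 - θ))).congr (fun j => by ring)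
  have hasum : Summable a := Summable.of_nonneg_of_le hann hamaj hmajsum
  refine ⟨∑' j, a j, hasum.hasSum, ?_⟩
  -- bound on every partial sum
  apply Real.tsum_le_of_sum_range_le hann
  intro N
  have hsub : ∑ j ∈ range N, a j ≤ ∑ j ∈ range (J + N), a j :=
    sum_le_sum_of_subset_of_nonneg
      (fun x hx => mem_range.2 (lt_of_lt_of_le (mem_range.1 hx) (Nat.le_add_left N J))) (fun j _ _ => hann j)
  rw [sum_range_add] at hsub
  -- head: j < J
  have hhead : ∑ j ∈ range J, a j ≤ ρ ^ J * (m - 1) := by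
    have h1 : ∀ j ∈ range J, a j ≤ ρ ^ J * (1 - ∑ k ∈ range (j + 2), f k) := fun j hj => by
      have hjJ : j + 1 ≤ J := by have := mem_range.1 hj; omega
      calc a j = (1 - ∑ k ∈ range (j + 2), f k) * ρ ^ (j + 1) := rfl
        _ ≤ (1 - ∑ k ∈ range (j + 2), f k) * ρ ^ J :=
            mul_le_mul_of_nonneg_left (pow_le_pow_right₀ hρ hjJ) (hrnn' j)
        _ = ρ ^ J * (1 - ∑ k ∈ range (j + 2), f k) := mul_comm _ _
    have h2 : ∑ j ∈ range J, (1 - ∑ k ∈ range (j + 2), f k) ≤ m - 1 :=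
      sum_le_hasSum (range J) (fun j _ => hrnn' j) hr'
    calc ∑ j ∈ range J, a j ≤ ∑ j ∈ range J, ρ ^ J * (1 - ∑ k ∈ range (j + 2), f k) := sum_le_sum h1
      _ = ρ ^ J * ∑ j ∈ range J, (1 - ∑ k ∈ range (j + 2), f k) := by rw [mul_sum]
      _ ≤ ρ ^ J * (m - 1) := mul_le_mul_of_nonneg_left h2 (pow_nonneg hρ0.le J)
  -- tail: j = J + i
  have htl : ∑ i ∈ range N, a (J + i) ≤ C * θ ^ (J + 2) * ρ ^ (J + 1) / ((1 - θ) * (1 - θ * ρ)) := by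
    have hT0 : 0 ≤ C * θ ^ (J + 2) * ρ ^ (J + 1) / (1 - θ) := by positivity
    have h1 : ∀ i ∈ range N, a (J + i) ≤ C * θ ^ (J + 2) * ρ ^ (J + 1) / (1 - θ) * (θ * ρ) ^ i :=
      fun i _ => by
        calc a (J + i) ≤ C * θ / (1 - θ) * (θ * ρ) ^ (J + i + 1) := hamaj (J + i)
          _ = C * θ ^ (J + 2) * ρ ^ (J + 1) / (1 - θ) * (θ * ρ) ^ i := by
              rw [mul_pow, mul_pow]; field_simp; ring
    have hgeom : HasSum (fun i : ℕ => C * θ ^ (J + 2) * ρ ^ (J + 1) / (1 - θ) * (θ * ρ) ^ i)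
        (C * θ ^ (J + 2) * ρ ^ (J + 1) / (1 - θ) * (1 - θ * ρ)⁻¹) :=
      (hasSum_geometric_of_lt_one hθρ0 hθρ).mul_left _
    have h2 := sum_le_hasSum (range N) (fun i _ => mul_nonneg hT0 (pow_nonneg hθρ0 i)) hgeom
    calc ∑ i ∈ range N, a (J + i) ≤ ∑ i ∈ range N, C * θ ^ (J + 2) * ρ ^ (J + 1) / (1 - θ) * (θ * ρ) ^ i :=
          sum_le_sum h1
      _ ≤ C * θ ^ (J + 2) * ρ ^ (J + 1) / (1 - θ) * (1 - θ * ρ)⁻¹ := h2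
      _ = C * θ ^ (J + 2) * ρ ^ (J + 1) / ((1 - θ) * (1 - θ * ρ)) := by
          have h1 : (1 - θ) ≠ 0 := h1θ.ne'
          have h2 : (1 - θ * ρ) ≠ 0 := h1θρ.ne'
          field_simp
  linarith

/-- The second datum in closed form: for `ρ > 1`,
`H(ρ) = Σ_{j≥0} r_{j+1} Σ_{l≤j} ρ^l = (G(ρ) − (m − 1))/(ρ − 1)`, because `Σ_{l≤j} ρ^l = (ρ^{j+1} − 1)/(ρ − 1)`
and `Σ_{j≥0} r_{j+1} = m − 1`.
[cite: Feller1968, XIII.10] -/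
theorem hasSum_H_of_hasSum_G (hf : ∀ k, 0 ≤ f k) (hf0 : f 0 = 0) (hf1 : HasSum f 1)
    (hmean : Summable fun k : ℕ => (k : ℝ) * f k) {ρ G : ℝ} (hρ : 1 < ρ)
    (hG : HasSum (fun j : ℕ => (1 - ∑ k ∈ range (j + 2), f k) * ρ ^ (j + 1)) G) :
    HasSum (fun j : ℕ => (1 - ∑ k ∈ range (j + 2), f k) * ∑ l ∈ range (j + 1), ρ ^ l)
      ((G - ((∑' j : ℕ, (j : ℝ) * f j) - 1)) / (ρ - 1)) := by
  have hr' := hasSum_tailSum_succ hf hf0 hf1 hmean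
  have hρ1 : ρ - 1 ≠ 0 := sub_ne_zero.2 (ne_of_gt hρ)
  have h := (hG.sub hr').div_const (ρ - 1)
  have heq : (fun j : ℕ => (1 - ∑ k ∈ range (j + 2), f k) * ∑ l ∈ range (j + 1), ρ ^ l)
      = fun j : ℕ => ((1 - ∑ k ∈ range (j + 2), f k) * ρ ^ (j + 1) - (1 - ∑ k ∈ range (j + 2), f k)) / (ρ - 1) := by
    funext j
    rw [geom_sum_eq (ne_of_gt hρ) (j + 1)]
    field_simp
  rw [heq]
  exact h

end RenewalRate

/-! ## §2 The wall-bridge law: explicit data and the explicit rate -/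

variable {y : ℝ}

/-- The envelope tail beyond the cut `J` at weight `ρ`:
`rateTail y ρ J = μ²√y · θ^{J+2} ρ^{J+1} / ((1 − θ)(1 − θρ))` with `θ = μ²/√y`.
[cite: BeatonBousquetMelouDeGierDuminilCopinGuttmann2014, §3.1 Proposition 5] -/
noncomputable def rateTail (y ρ : ℝ) (J : ℕ) : ℝ :=
  hexConnectiveConstant ^ 2 * Real.sqrt y * (hexConnectiveConstant ^ 2 / Real.sqrt y) ^ (J + 2) * ρ ^ (J + 1) /
    ((1 - hexConnectiveConstant ^ 2 / Real.sqrt y) * (1 - hexConnectiveConstant ^ 2 / Real.sqrt y * ρ))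

/-- ★ Explicit renewal-rate data for the adsorbed wall-bridge law: for `y > μ⁴`, `1 < ρ`, `θρ < 1` and a cut `J`
there are `G`, `H` with the parent's `HasSum` hypotheses, `G ≤ ρ^J (m(y) − 1) + rateTail y ρ J` and
`H = (G − (m(y) − 1))/(ρ − 1)`.
[cite: MadrasSlade1993, §4.2 and Appendix B] -/
theorem exists_rate_data (hy : hexConnectiveConstant ^ 4 < y) {ρ : ℝ} (hρ : 1 < ρ)
    (hθρ : hexConnectiveConstant ^ 2 / Real.sqrt y * ρ < 1) (J : ℕ) :
    ∃ G H : ℝ, HasSum (fun j : ℕ => (1 - ∑ k ∈ range (j + 2), pwbLaw y k) * ρ ^ (j + 1)) G ∧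
      HasSum (fun j : ℕ => (1 - ∑ k ∈ range (j + 2), pwbLaw y k) * ∑ l ∈ range (j + 1), ρ ^ l) H ∧
      G ≤ ρ ^ J * (pwbMean y - 1) + rateTail y ρ J ∧ H = (G - (pwbMean y - 1)) / (ρ - 1) := by
  have hμ := hexConnectiveConstant_pos
  have hμ1 : 1 < hexConnectiveConstant := HV.one_lt_hexConnectiveConstant
  have hμ41 : 1 ≤ hexConnectiveConstant ^ 4 := one_le_pow₀ hμ1.le
  have hy1 : 1 ≤ y := by linarith
  have hy0 : 0 < y := by linarith
  have hsq : 0 < Real.sqrt y := Real.sqrt_pos.2 hy0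
  have hθ0 : 0 ≤ hexConnectiveConstant ^ 2 / Real.sqrt y := by positivity
  have hθ1 : hexConnectiveConstant ^ 2 / Real.sqrt y < 1 := by
    rw [div_lt_one hsq]
    have h4 : hexConnectiveConstant ^ 4 = (hexConnectiveConstant ^ 2) ^ 2 := by ring
    have hs : Real.sqrt (hexConnectiveConstant ^ 4) = hexConnectiveConstant ^ 2 := by
      rw [h4, Real.sqrt_sq (by positivity)]
    rw [← hs]
    exact Real.sqrt_lt_sqrt (by positivity) hy
  have hC : 0 ≤ hexConnectiveConstant ^ 2 * Real.sqrt y := by positivity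
  obtain ⟨G, hG, hGle⟩ := RenewalRate.exists_hasSum_weighted_tail_le (pwbLaw_nonneg hy0.le) pwbLaw_zero
    (hasSum_pwbLaw hy) (summable_mul_pwbLaw hy) hC (pwbLaw_le_geom hy1) hθ0 hθ1 hρ.le hθρ J
  refine ⟨G, (G - (pwbMean y - 1)) / (ρ - 1), hG, ?_, ?_, rfl⟩
  · exact RenewalRate.hasSum_H_of_hasSum_G (pwbLaw_nonneg hy0.le) pwbLaw_zero (hasSum_pwbLaw hy)
      (summable_mul_pwbLaw hy) hρ hG
  · simpa [rateTail, pwbMean] using hGle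

/-- ★★ EXPLICIT GEOMETRIC RATE OF THE ADSORBED WALL-BRIDGE RENEWAL.  For `y > μ⁴`, a weight `1 < ρ` with
`θρ < 1` (`θ = μ²/√y`), a cut `J : ℕ`, any certified mean bound `pwbMean y ≤ mup` (e.g. from the sibling module
`HexSAWSurfaceWallRenewalMean`) and any `G₀` with `ρ^J (mup − 1) + rateTail y ρ J ≤ G₀ < 1`:
`|pwbAmp y s − (pwbMean y)⁻¹| ≤ G₀/((ρ − 1)(1 − G₀)) · ρ⁻¹ ^ s` for every `s`
(the parent's `abs_pwbAmp_sub_inv_pwbMean_le` fed with `exists_rate_data`, `H ≤ G/(ρ − 1)`, `m(y) ≥ 1`).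
Illustrative (floating point, not certified): `y = 50`, `mup = 1.041`, `ρ = 1.2`, `J = 11`, `G₀ = 0.38` ⇒
`|P_{2s}β^{-2s} − 1/m| ≤ 3.1 · 1.2^{-s}`.
[cite: Feller1968, XIII.10; MadrasSlade1993, §4.2] -/
theorem abs_pwbAmp_sub_inv_pwbMean_le_explicit (hy : hexConnectiveConstant ^ 4 < y) {ρ : ℝ} (hρ : 1 < ρ)
    (hθρ : hexConnectiveConstant ^ 2 / Real.sqrt y * ρ < 1) (J : ℕ) {mup : ℝ} (hm : pwbMean y ≤ mup)
    {G₀ : ℝ} (hG0 : ρ ^ J * (mup - 1) + rateTail y ρ J ≤ G₀) (hG01 : G₀ < 1) (s : ℕ) :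
    |pwbAmp y s - (pwbMean y)⁻¹| ≤ G₀ / ((ρ - 1) * (1 - G₀)) * ρ⁻¹ ^ s := by
  obtain ⟨G, H, hG, hH, hGle, hHeq⟩ := exists_rate_data hy hρ hθρ J
  have hm1 : 1 ≤ pwbMean y := one_le_pwbMean hy
  have hρ0 : 0 < ρ := by linarith
  have hGG0 : G ≤ G₀ := by
    have : ρ ^ J * (pwbMean y - 1) ≤ ρ ^ J * (mup - 1) :=
      mul_le_mul_of_nonneg_left (by linarith) (pow_nonneg hρ0.le J)
    linarith
  have hG1 : G < 1 := lt_of_le_of_lt hGG0 hG01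
  have hrate := abs_pwbAmp_sub_inv_pwbMean_le hy hρ.le hG hG1 hH s
  have hy0 : 0 < y := by
    have : 1 ≤ hexConnectiveConstant ^ 4 := one_le_pow₀ (HV.one_lt_hexConnectiveConstant).le
    linarith
  -- H ≥ 0 (nonnegative terms) and H ≤ G/(ρ - 1) ≤ G₀/(ρ - 1)
  have hrnn : ∀ j, 0 ≤ 1 - ∑ k ∈ range (j + 2), pwbLaw y k := fun j => by
    have := sum_le_hasSum (range (j + 2)) (fun k _ => pwbLaw_nonneg hy0.le k) (hasSum_pwbLaw hy)
    linarith
  have hH0 : 0 ≤ H :=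
    hH.nonneg fun j => mul_nonneg (hrnn j) (sum_nonneg fun l _ => pow_nonneg hρ0.le l)
  have hGnn : 0 ≤ G := hG.nonneg fun j => mul_nonneg (hrnn j) (pow_nonneg hρ0.le _)
  have hHle : H ≤ G₀ / (ρ - 1) := by
    rw [hHeq]
    exact div_le_div_of_nonneg_right (by linarith) (by linarith)
  have hden : 1 - G₀ ≤ pwbMean y * (1 - G) := by nlinarith
  have hkey : H / (pwbMean y * (1 - G)) ≤ G₀ / ((ρ - 1) * (1 - G₀)) := by
    rw [show G₀ / ((ρ - 1) * (1 - G₀)) = G₀ / (ρ - 1) / (1 - G₀) by rw [div_div]]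
    exact div_le_div₀ (div_nonneg (by linarith) (by linarith)) hHle (by linarith) hden
  exact hrate.trans (mul_le_mul_of_nonneg_right hkey (pow_nonneg (inv_nonneg.2 hρ0.le) s))

/-- The same with the amplitude unfolded: `|PWB (2s) y / wallRate y ^ (2s) − (pwbMean y)⁻¹| ≤ …`.
[cite: MadrasSlade1993, §4.2] -/
theorem abs_PWB_div_sub_inv_pwbMean_le_explicit (hy : hexConnectiveConstant ^ 4 < y) {ρ : ℝ} (hρ : 1 < ρ)
    (hθρ : hexConnectiveConstant ^ 2 / Real.sqrt y * ρ < 1) (J : ℕ) {mup : ℝ} (hm : pwbMean y ≤ mup)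
    {G₀ : ℝ} (hG0 : ρ ^ J * (mup - 1) + rateTail y ρ J ≤ G₀) (hG01 : G₀ < 1) (s : ℕ) :
    |PWB (2 * s) y / wallRate y ^ (2 * s) - (pwbMean y)⁻¹| ≤ G₀ / ((ρ - 1) * (1 - G₀)) * ρ⁻¹ ^ s :=
  abs_pwbAmp_sub_inv_pwbMean_le_explicit hy hρ hθρ J hm hG0 hG01 s

end Literature.Probability.RandomPlanarGeometry.SAW.HexBW.Wall
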